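import Summits.ResolutionOfSingularities.ResolutionOfSingularities.Theorems.HilbertSamuelEliminationSigmaMaxModificationsCorridor3WLadderMoving
import HarnessLib

/-!
# [OURS · L1 W4.2] MODULE `Corridor3WLadderMoving` (crux chain w42, helpers v3.6, CHAIN v3.7) — the MOVING W-ladder
# — part 3/3: the PROVED reductions of §MD (moving rows by name: joins, doors, cut, graded bridges)

PROVENANCE / SPLIT FOR THE GATE (typer res-type-053, res-L1-w42-plan-1 TAKE + TYPING-WANTED 2026-08-27T04:09:15Z): the three
tree modules `…Corridor3WLadderMovingDefs` (every DEFINITION, in the original order), `…Corridor3WLadderMoving` (the PROVED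
reductions of §1–§3c) and `…Corridor3WLadderMovingRows` (the PROVED reductions of §MD) land plan-1's helpers v3.6
`HOME/L/w42/Corridor3WLadderMoving.lean` (sha16 `5411d44e07615426`, 785 l.) with every declaration BYTE-IDENTICAL and in the SAME
namespace `…Theorems.SigmaMaxModificationsCorridor3.Moving` (so the registered stub signatures of skeleton `w_ladder` v5 keep
their constant names): the gate caps Theorems files with proofs at 400 lines and relocates tagged parameterless `def : Prop`s of
Theorems files to Literature/, hence defs are hoisted into the `…Defs` module and the three PARAMETERLESS `Prop`s
`MovingCompactness`, `WA3M`, `WB3M` carry their CJS pointers in prose instead of a `[cite: …]` tag (OURS nodes, not citations of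
print); eight theorems that had no docstring in v3.6 received one-line docstrings (`dirDim_le_geomDirDim`, the six §MD.1
`…M_of_…` transfers, `bridge3SeqM_of_bridge3Seq`). Nothing else differs. `import …Corridor3WLadderMovingRows` gives all three.
idea-2's / plan-1's module docstring follows unchanged.

See `…Corridor3WLadderMovingDefs` for the full module docstring (defect repaired, L∞ proof sketch, references).
OURS (cell res-hironaka, slot W4.2, crux chain w42); NOT statements of the manuscript [Hironaka2017] nor of
[CossartJannsenSaito2020]; AI-drafted, weaker than expert review. Every `theorem` below is PROVED. -/

noncomputable section

-- plan-1/idea-2 module setting kept verbatim (namespace `…Corridor3.Moving` re-enters `…Corridor3`)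
set_option linter.dupNamespace false

open CategoryTheory AlgebraicGeometry TopologicalSpace
open Summit.ResolutionOfSingularities.ResolutionOfSingularities.Theorems.CampaignW42
open Literature.AlgebraicGeometry.Resolution Literature.RingTheory.HilbertSamuel
open Literature.AlgebraicGeometry.CossartJannsenSaito2020
open Summit.ResolutionOfSingularities.ResolutionOfSingularities.Theses.HilbertSamuelElimination
open Summit.ResolutionOfSingularities.ResolutionOfSingularities.Theorems.SigmaMaxModificationsCorridor3

namespace Summit.ResolutionOfSingularities.ResolutionOfSingularities.Theorems.SigmaMaxModificationsCorridor3.Moving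

universe u

variable {R : ∀ S : Scheme.{u}, CentreSeq S → Prop} {N : ℕ} {ν : ℕ → ℕ}

section RowsM

open Summit.ResolutionOfSingularities.ResolutionOfSingularities.Theorems.SigmaMaxModificationsCorridor3.Helpers
  (InScopeC ClosedOriginNoNearChainAt ClosedOriginGeomDirDimNonincrease ClosedOriginNoNearChainAtQ QPerfectResidueField
   QPointed QCharRegime Wlow3Char Wlow3Two Wlow3TwoPerfect Wlow3TwoImperfect Wtop3Pointed Wtop3Nonpointed Bridge3 Bridge3Seq)

/-- Restriction to `Q`-origins. [folklore] -/
theorem MaxOriginNoMovingNearChainAt.toQ {p N : ℕ} {G : MarkedStage.{u} → Prop}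
    (h : MaxOriginNoMovingNearChainAt p N G) (Q : ℕ → (ℕ → ℕ) → ∀ X : Scheme.{u}, X → Prop) :
    MaxOriginNoMovingNearChainAtQ p N Q G :=
  fun R hF hA ν X _ x hx _ => h R hF hA ν X x hx

/-- SPLIT: the `Q`-half and the `¬Q`-half give the whole moving row. [folklore] -/
theorem maxOriginNoMovingNearChainAt_of_split {p N : ℕ} (Q : ℕ → (ℕ → ℕ) → ∀ X : Scheme.{u}, X → Prop)
    {G : MarkedStage.{u} → Prop} (hQ : MaxOriginNoMovingNearChainAtQ p N Q G)
    (hnQ : MaxOriginNoMovingNearChainAtQ p N (fun N ν X x => ¬ Q N ν X x) G) :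
    MaxOriginNoMovingNearChainAt p N G := by
  intro R hF hA ν X _ x hx
  by_cases hq : Q N ν X x
  · exact hQ R hF hA ν X x hx hq
  · exact hnQ R hF hA ν X x hx hq

/-- Shrinking the grade: no moving `G`-chain ⇒ no moving `G'`-chain for `G' ≤ G`. [folklore] -/
theorem MaxOriginNoMovingNearChainAtQ.mono {p N : ℕ} {Q : ℕ → (ℕ → ℕ) → ∀ X : Scheme.{u}, X → Prop}
    {G G' : MarkedStage.{u} → Prop} (h : MaxOriginNoMovingNearChainAtQ p N Q G) (hGG' : ∀ s, G' s → G s) :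
    MaxOriginNoMovingNearChainAtQ p N Q G' := by
  intro R hF hA ν X _ x hx hq
  rintro ⟨c, h0, hstep, hG, hmov⟩
  exact h R hF hA ν X x hx hq ⟨c, h0, hstep, fun n => hGG' _ (hG n), hmov⟩

/-- A landed (v4) `Q`-row implies its MOVING form — nothing proved for the v4 typing is lost. [folklore] -/
theorem maxOriginNoMovingNearChainAtQ_of_closedOriginQ {p N : ℕ} {Q : ℕ → (ℕ → ℕ) → ∀ X : Scheme.{u}, X → Prop}
    {G : MarkedStage.{u} → Prop} (h : ClosedOriginNoNearChainAtQ.{u} p N Q G) :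
    MaxOriginNoMovingNearChainAtQ.{u} p N Q G :=
  fun R hF hA ν X _ x hx hq => (h R hF hA ν X x hx hq).noMoving

/-- JOIN β ∧ γ ⇒ W-low-two, moving. [folklore] -/
theorem wlow3TwoM_of_regimes {p : ℕ} (hβ : Wlow3TwoPerfectM.{u} p) (hγ : Wlow3TwoImperfectM.{u} p) : Wlow3TwoM.{u} p := by
  intro e he R hF hA ν X _ x hx hq
  by_cases hk : QPerfectResidueField 3 ν X x
  · exact hβ e he R hF hA ν X x hx ⟨hq, hk⟩
  · exact hγ e he R hF hA ν X x hx ⟨hq, hk⟩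

/-- JOIN (F1)-regime ∧ complement ⇒ all exact low grades, moving. [folklore] -/
theorem wlow3M_of_char_two {p : ℕ} (hc : Wlow3CharM.{u} p) (ht : Wlow3TwoM.{u} p) :
    ∀ e ≤ 2, MaxOriginNoMovingNearChainAt.{u} p 3 fun s => s.geomDirDim = e :=
  fun e he => maxOriginNoMovingNearChainAt_of_split (QCharRegime p) (hc e he) (ht e he)

/-- JOIN pointed ∧ non-pointed ⇒ the top grade, moving (`WtopM`). [folklore] -/
theorem wtopM_of_pointed_nonpointed {p : ℕ} (hpt : Wtop3PointedM.{0} p) (hnpt : Wtop3NonpointedM.{0} p) : WtopM p :=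
  maxOriginNoMovingNearChainAt_of_split QPointed hpt hnpt

/-- **THE EXACT-GRADE SPLIT, MOVING (PROVED)**: with W-mono, `ē` is eventually constant along an infinite chain and a tail of a
moving chain is moving, so the exact low grades give the grade `ē ≤ 2`. [folklore] -/
theorem maxOriginNoMovingNearChainAt_low_of_exactGrades {p N : ℕ} (hmono : ClosedOriginGeomDirDimNonincrease.{u} p N)
    (hlow : ∀ e ≤ 2, MaxOriginNoMovingNearChainAt.{u} p N fun s => s.geomDirDim = e) :
    MaxOriginNoMovingNearChainAt.{u} p N fun s => s.geomDirDim ≤ 2 := by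
  intro R hRf hRa ν X _ x hX
  rintro ⟨c, h0, hstep, hle, hmov⟩
  have hsc : ∀ n, InScopeC p R N ν (c n) := fun n =>
    ⟨X, inferInstance, x, hX, reaches_chain h0 hstep n⟩
  have hg : ∀ n, (c (n + 1)).geomDirDim ≤ (c n).geomDirDim := fun n =>
    hmono R hRf hRa ν (c n) (c (n + 1)) (hsc n) (hstep n)
  obtain ⟨n₀, hn₀⟩ := eventually_const_of_succ_le (g := fun n => (c n).geomDirDim) hg
  exact hlow (c n₀).geomDirDim (hle n₀) R hRf hRa ν X x hX ⟨fun n => c (n₀ + n), reaches_chain h0 hstep n₀,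
    fun n => hstep (n₀ + n), fun n => by
      show (c (n₀ + n)).geomDirDim = (c n₀).geomDirDim
      exact hn₀ n, io_shift hmov n₀⟩

/-- JOIN: the two low rows ⇒ `WlowM` (given W-mono). [folklore] -/
theorem wlowM_of_char_two {p : ℕ} (hmono : ClosedOriginGeomDirDimNonincrease.{0} p 3) (hc : Wlow3CharM.{0} p)
    (ht : Wlow3TwoM.{0} p) : WlowM p :=
  maxOriginNoMovingNearChainAt_low_of_exactGrades hmono (wlow3M_of_char_two hc ht)

/-- **`WB3M` FROM THE FIVE MOVING ROWS OF LINE `w_ladder` v5 (PROVED)**: W-mono, W-low-char-M, W-low-two-M, W-top-pointed-M,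
W-top-nonpointed-M. [folklore] -/
theorem WB3M_of_rows5 (hmono : ∀ p : ℕ, p.Prime → ClosedOriginGeomDirDimNonincrease.{0} p 3)
    (hchar : ∀ p : ℕ, p.Prime → Wlow3CharM.{0} p) (htwo : ∀ p : ℕ, p.Prime → Wlow3TwoM.{0} p)
    (hpt : ∀ p : ℕ, p.Prime → Wtop3PointedM.{0} p) (hnpt : ∀ p : ℕ, p.Prime → Wtop3NonpointedM.{0} p) : WB3M :=
  WB3M_of_rows hmono (fun p hp => wlowM_of_char_two (hmono p hp) (hchar p hp) (htwo p hp))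
    fun p hp => wtopM_of_pointed_nonpointed (hpt p hp) (hnpt p hp)

/-! ### §MD.1 The landed (v4) rows and doors imply the moving rows -/

/-- The landed v4 row `Wlow3Char` implies its MOVING form. -/
theorem wlow3CharM_of_wlow3Char {p : ℕ} (h : Wlow3Char.{u} p) : Wlow3CharM.{u} p :=
  fun e he => maxOriginNoMovingNearChainAtQ_of_closedOriginQ (h e he)

/-- The landed v4 row `Wlow3Two` implies its MOVING form. -/
theorem wlow3TwoM_of_wlow3Two {p : ℕ} (h : Wlow3Two.{u} p) : Wlow3TwoM.{u} p :=
  fun e he => maxOriginNoMovingNearChainAtQ_of_closedOriginQ (h e he)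

/-- The landed v4 helper row β `Wlow3TwoPerfect` implies its MOVING form. -/
theorem wlow3TwoPerfectM_of_wlow3TwoPerfect {p : ℕ} (h : Wlow3TwoPerfect.{u} p) : Wlow3TwoPerfectM.{u} p :=
  fun e he => maxOriginNoMovingNearChainAtQ_of_closedOriginQ (h e he)

/-- The landed v4 helper row γ `Wlow3TwoImperfect` implies its MOVING form. -/
theorem wlow3TwoImperfectM_of_wlow3TwoImperfect {p : ℕ} (h : Wlow3TwoImperfect.{u} p) : Wlow3TwoImperfectM.{u} p :=
  fun e he => maxOriginNoMovingNearChainAtQ_of_closedOriginQ (h e he)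

/-- The landed v4 row `Wtop3Pointed` implies its MOVING form. -/
theorem wtop3PointedM_of_wtop3Pointed {p : ℕ} (h : Wtop3Pointed.{u} p) : Wtop3PointedM.{u} p :=
  maxOriginNoMovingNearChainAtQ_of_closedOriginQ h

/-- The landed v4 row `Wtop3Nonpointed` implies its MOVING form. -/
theorem wtop3NonpointedM_of_wtop3Nonpointed {p : ℕ} (h : Wtop3Nonpointed.{u} p) : Wtop3NonpointedM.{u} p :=
  maxOriginNoMovingNearChainAtQ_of_closedOriginQ h

/-- **DOOR (PROVED): the pointed moving W-top row from the campaign's isolated-origin O2 at grade 3**, `TertiaryTerminationAt p 3`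
(informal crux stmt-…-17846 at `e = 3`; item `CampaignW42TertiaryTermination`). [folklore] -/
theorem wtop3PointedM_of_tertiaryTerminationAt {p : ℕ} (h : TertiaryTerminationAt.{u} p 3) : Wtop3PointedM.{u} p :=
  wtop3PointedM_of_wtop3Pointed (Helpers.wtop3Pointed_of_tertiaryTerminationAt h)

/-- **DOOR (PROVED): both low moving rows from s42's maximal-origin items `NearChainTerminationAt p e`, `e ≤ 2`** (item
`CampaignW42NearChainTermination` gives all `e`). [folklore] -/
theorem wlow3M_of_nearChainTerminationAt {p : ℕ} (h : ∀ e ≤ 2, NearChainTerminationAt.{u} p e) :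
    Wlow3CharM.{u} p ∧ Wlow3TwoM.{u} p :=
  ⟨wlow3CharM_of_wlow3Char (Helpers.wlow3_of_nearChainTerminationAt h).1,
   wlow3TwoM_of_wlow3Two (Helpers.wlow3_of_nearChainTerminationAt h).2⟩

/-! ### §MD.2 The isolation-recurrence cut of §3a restricted to `Q`-origins (ruling (B2): the plan INSIDE `Wlow3CharM`) -/

/-- The recurrence split at `Q`-row level (proved): tail row (`G ∧ ¬B` throughout) + recurrent row (`B` infinitely often) ⇒ row.
[folklore] -/
theorem maxOriginNoMovingNearChainAtQ_of_recurrence {p N : ℕ} {Q : ℕ → (ℕ → ℕ) → ∀ X : Scheme.{u}, X → Prop}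
    {G B : MarkedStage.{u} → Prop} (htail : MaxOriginNoMovingNearChainAtQ p N Q fun s => G s ∧ ¬ B s)
    (hrec : MaxOriginNoMovingRecurrentNearChainAtQ p N Q G B) : MaxOriginNoMovingNearChainAtQ p N Q G :=
  fun R hRf hRa ν X _ x hX hq =>
    (noMovingNearChainFrom_iff_recurrence B).2 ⟨htail R hRf hRa ν X x hX hq, hrec R hRf hRa ν X x hX hq⟩

/-- The all-regime extraction of §3a gives the (F1)-regime one. [folklore] -/
theorem unitTowerExtractionQM_of_unitTowerExtractionM {p : ℕ} (h : UnitTowerExtractionM p) : UnitTowerExtractionQM p :=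
  fun R hRf hRa ν X _ x hX _ => h R hRf hRa ν X x hX

/-- **PROVED REDUCTION: the UNITS-half of `Wlow3CharM` from F-key `KeyTheorem640_char_isolated` + low-directrix termination +
the (F1)-regime extraction.** [cite: CossartJannsenSaito2020, Thm. 6.40, Cor. 6.37] -/
theorem wlow3CharUnitsM_of_extraction {p : ℕ} (hK : KeyTheorem640_char_isolated.{0})
    (hlow : IsoLowDirDimTerminatesM p) (hext : UnitTowerExtractionQM p) : Wlow3CharUnitsM p := by
  intro R hRf hRa ν X _ x hX hq
  rintro ⟨c, h0, hstep, hG, hmov, hrec⟩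
  by_cases hlowstage : ∃ m, Iso 3 (c m) ∧ dirDim (c m) ≤ 1
  · obtain ⟨m, hiso, hdir⟩ := hlowstage
    have hscope : InScopeM p R 3 ν (c m) := ⟨X, ‹_›, x, hX, reaches_chain h0 hstep m⟩
    exact hlow R hRf hRa ν (c m) hscope hiso hdir
      ⟨fun n => c (m + n), Relation.ReflTransGen.refl, fun n => hstep (m + n), fun _ => trivial, io_shift hmov m⟩
  · push Not at hlowstage
    have he : ∀ n, Iso 3 (c n) → dirDim (c n) = 2 ∧ (c n).geomDirDim = 2 := by
      intro n hiso
      have h1 := hlowstage n hiso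
      have h2 := dirDim_le_geomDirDim (c n)
      have h3 := hG n
      exact ⟨by omega, by omega⟩
    obtain ⟨T, len, pt, hset, hchar, hchain, hisoT⟩ := hext R hRf hRa ν X x hX hq c h0 hstep hG hmov hrec he
    exact hK T 3 len pt hset hchar hchain hisoT

/-- **JOIN (PROVED): units-half + strata-half ⇒ `Wlow3CharM`** (the exact grades `e ≤ 2` are sub-grades of `ē ≤ 2`). [folklore] -/
theorem wlow3CharM_of_units_strata {p : ℕ} (hU : Wlow3CharUnitsM p) (hS : Wlow3CharStrataM p) : Wlow3CharM.{0} p :=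
  fun e he => (maxOriginNoMovingNearChainAtQ_of_recurrence hS hU).mono fun s hs => by
    show s.geomDirDim ≤ 2
    omega

/-- **`Wlow3CharM` assembled (PROVED reduction)**: F-key `KeyTheorem640_char_isolated` + `IsoLowDirDimTerminatesM` +
`UnitTowerExtractionQM` + `Wlow3CharStrataM`. [cite: CossartJannsenSaito2020, Thm. 6.40, Cor. 6.37, Thm. 6.35] -/
theorem wlow3CharM_assembled {p : ℕ} (hK : KeyTheorem640_char_isolated.{0}) (hlow : IsoLowDirDimTerminatesM p)
    (hext : UnitTowerExtractionQM p) (hS : Wlow3CharStrataM p) : Wlow3CharM.{0} p :=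
  wlow3CharM_of_units_strata (wlow3CharUnitsM_of_extraction hK hlow hext) hS

/-! ### §MD.3 Graded MOVING bridges (v4's `Bridge3` / `Bridge3Seq` with the moving hypothesis; strictly weaker obligations) -/

/-- The landed bridges imply the moving ones (the moving hypothesis is simply dropped). [folklore] -/
theorem bridge3M_of_bridge3 {p : ℕ} (h : Bridge3 p) : Bridge3M p :=
  fun R hRf hRa ν X _ x hX hq c h0 hstep hgr _ => h R hRf hRa ν X x hX hq c h0 hstep hgr

/-- The landed point-sequence bridge `Bridge3Seq` implies the moving one. -/
theorem bridge3SeqM_of_bridge3Seq {p : ℕ} (h : Bridge3Seq p) : Bridge3SeqM p :=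
  fun R hRf hRa ν X _ x hX hq c h0 hstep hgr _ => h R hRf hRa ν X x hX hq c h0 hstep hgr

/-- **Grade 2 of `Wlow3CharM` from F-key Thm. 6.40 and the moving unit bridge (PROVED reduction).** [cite: CossartJannsenSaito2020, Thm. 6.40] -/
theorem wlow3CharM_e2_of_bridgeM {p : ℕ} (hK : KeyTheorem640_char.{0}) (hB : Bridge3M p) :
    MaxOriginNoMovingNearChainAtQ.{0} p 3 (QCharRegime p) fun s => s.geomDirDim = 2 := by
  intro R hRf hRa ν X _ x hx hq
  rintro ⟨c, hreach, hstep, hgrade, hmov⟩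
  obtain ⟨T, len, pt, hset, hchar, hchain, hiso⟩ := hB R hRf hRa ν X x hx hq c hreach hstep hgrade hmov
  exact hK T 3 len pt hset hchar hchain hiso

/-- **Grade 1 of `Wlow3CharM` from F-key Cor. 6.37 and the moving point-sequence bridge (PROVED reduction).**
[cite: CossartJannsenSaito2020, Cor. 6.37] -/
theorem wlow3CharM_e1_of_bridgeSeqM {p : ℕ} (hC : Corollary637_char.{0}) (hB : Bridge3SeqM p) :
    MaxOriginNoMovingNearChainAtQ.{0} p 3 (QCharRegime p) fun s => s.geomDirDim = 1 := by
  intro R hRf hRa ν X _ x hx hq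
  rintro ⟨c, hreach, hstep, hgrade, hmov⟩
  obtain ⟨T, x₀, hset, hchar, hF, hiso, he⟩ := hB R hRf hRa ν X x hx hq c hreach hstep hgrade hmov
  exact lt_irrefl _ (hC T 3 x₀ ⊤ hset hchar hF hiso he).1

/-- **`Wlow3CharM` from its three exact grades (PROVED join).** [folklore] -/
theorem wlow3CharM_of_grades {p : ℕ}
    (h0 : MaxOriginNoMovingNearChainAtQ.{0} p 3 (QCharRegime p) fun s => s.geomDirDim = 0)
    (h1 : MaxOriginNoMovingNearChainAtQ.{0} p 3 (QCharRegime p) fun s => s.geomDirDim = 1)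
    (h2 : MaxOriginNoMovingNearChainAtQ.{0} p 3 (QCharRegime p) fun s => s.geomDirDim = 2) : Wlow3CharM.{0} p := by
  intro e he
  interval_cases e
  · exact h0
  · exact h1
  · exact h2

end RowsM

end Summit.ResolutionOfSingularities.ResolutionOfSingularities.Theorems.SigmaMaxModificationsCorridor3.Moving

end
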